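import Literature.AlgebraicGeometry.ShimuraVarieties.UnitaryBallSpecialCurveEmbedding
import Literature.AlgebraicGeometry.Motives.ProjectiveManifoldSmooth
import Literature.AlgebraicGeometry.HodgeTheory.AnalytificationImmersiveClosedImmersion
import Literature.NumberTheory.Transcendental.AnalytificationFunctorialityProofs
import Literature.AlgebraicGeometry.Motives.VarietiesProjectiveSpaceProofs
import Literature.Geometry.Kaehler.HolomorphicMapSmooth
import HarnessLib

/-!
# Special curves of a compact arithmetic ball quotient are SMOOTH projective closed subschemes (at injective level)

Topic `AlgebraicGeometry/ShimuraVarieties`; namespace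
`Literature.AlgebraicGeometry.ShimuraVarieties.UnitaryBallQuotientDatum`.  THEOREMS ONLY.  Sequel of
`UnitaryBallSpecialCurveEmbedding` (the special curve `Γ_W∖𝔹_W` as a compact complex `1`-manifold
closed-embedded in `S(Γ)`).  For a compact ball-quotient datum `D : UnitaryBallQuotientDatum 2 X` (so `X` is a
smooth projective surface over `ℂ` with `X(ℂ) ≅ Γ∖𝔹²` and, for every totally positive `E`-subspace `W`, a
Zariski-closed special subvariety `D.specialSubvariety W ⊆ X` whose complex points are the image of the sub-ball
`𝔹(W^⊥)`), a Sylvester frame `𝔣` and `s : D.DiscVec 𝔣` generating a totally positive LINE `W = E·s`, we PROVE,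
under the injectivity hypothesis of the level
`hinj : ∀ γ ∈ Γ, (∃ z ∈ 𝔹_W, γ z ∈ 𝔹_W) → γ ∈ Γ_W` ([Deligne 1971, Prop. 1.15] at small level):

* `contMDiff_projEmb`, `injective_projEmb`, `injective_mfderiv_projEmb` — for a projective embedding
  `ι : X ↪ ℙᴺ_ℂ`, the map `S(Γ) → ℙᴺ(ℂ)` over `ι` is a holomorphic injective IMMERSION (GAGA functoriality
  `IsAnalytification.mdifferentiable_comp_map_holds` + `IsAnalytification.injective_mfderiv_of_isClosedImmersion`);
* **`exists_specialCurveSubscheme`** — there is a REDUCED CLOSED SUBSCHEME `κ : Z ↪ X` with underlying set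
  `D.specialSubvariety W`, SMOOTH PROJECTIVE OF DIMENSION `1` over `ℂ`, analytified by the compact Riemann surface
  `Γ_W∖𝔹_W` (`IsAnalytification (Fin 1 → ℂ) Z 1 φ₁`) compatibly with `Γ_W∖𝔹_W → S(Γ) ≅ X(ℂ)`:  the reduced induced
  structure (`ProjectiveManifold.exists_isClosedImmersion_isReduced_range_eq`, Hartshorne II 3.2.6) is analytified by
  `Γ_W∖𝔹_W` through `Z ↪ X ↪ ℙᴺ` (`ProjectiveManifold.exists_isAnalytification_of_range_map_eq`, Serre GAGA §2 n°5)
  and is therefore smooth projective of dimension `1` (`ProjectiveManifold.isSmoothProjective_of_isAnalytification`,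
  Serre GAGA §2 n°6 Prop. 3 Cor. 2).

This is leaf R2-2 of road (ii) «embedded-curve descent» of the cell `hodgecm-mathlib` (census
`CENSUS-GS3-of-Mumford` §4 / `CENSUS-R2-2-Q2`): the special curves of the surface's canonical-model pieces are
smooth projective CURVES, the complex pieces of the canonical model of the Shimura curve `Sh(U(W^⊥))`.
Everything is PROVED; no named facts, no definitions.

References: J.-P. Serre, *Géométrie algébrique et géométrie analytique*, Ann. Inst. Fourier 6 (1956), §2 n°5
Prop. 2, n°6 Prop. 3 Cor. 2; R. Hartshorne, *Algebraic Geometry*, II Example 3.2.6; S. Kudla, J. Millson,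
Publ. Math. IHÉS 71 (1990), Lemma 1.1 and p. 133; N. Bergeron, J. Millson, C. Moeglin, Acta Math. 216 (2016),
Introduction §1.7, Part 2 §3.2; P. Deligne, *Travaux de Shimura*, Sém. Bourbaki 389 (1971), Prop. 1.15.
HC_CM is proved only modulo the 7 printed citations until rung 0 closes; nothing here is in a registered cone.
-/

set_option autoImplicit false

noncomputable section

open scoped Manifold ContDiff Topology LinearAlgebra.Projectivization
open Set Function MulAction CategoryTheory AlgebraicGeometry
open Literature.Geometry.ComplexHyperbolic
open Literature.Geometry.ComplexHyperbolic.BallModel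
open Literature.NumberTheory.Transcendental

namespace Literature.AlgebraicGeometry.ShimuraVarieties

open Literature.AlgebraicGeometry.Motives

namespace UnitaryBallUniformisationDatum

variable {X₂ : SchemeOver ℂ} (D : UnitaryBallUniformisationDatum 2 X₂) (𝔣 : D.SylvesterFrame)

/-! ### §1 The projective embedding of `S(Γ)` read on the complex surface -/

section ProjEmb

variable {N : ℕ} (ι : X₂ ⟶ projectiveSpace N ℂ)

/-- The map `S(Γ) → ℙᴺ(ℂ)` over a projective embedding `ι : X ↪ ℙᴺ_ℂ`:
`projPoint ∘ projEmb = ι(ℂ) ∘ (S(Γ) ≃ X(ℂ))`. [cite: SerreGAGA1956, §2 (fonctorialité)] -/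
def projEmb (m : D.quotientSurface 𝔣) : ℙ ℂ (Fin (N + 1) → ℂ) :=
  (isHomeomorph_projPoint N).homeomorph.symm (AlgPoints.map ι (D.quotientSurfaceHomeomorph 𝔣 m))

/-- `projPoint (projEmb m) = ι(ℂ) (m)`. [cite: SerreGAGA1956, §2 (fonctorialité)] -/
theorem projPoint_projEmb (m : D.quotientSurface 𝔣) :
    projPoint N (D.projEmb 𝔣 ι m) = AlgPoints.map ι (D.quotientSurfaceHomeomorph 𝔣 m) :=
  (isHomeomorph_projPoint N).homeomorph.apply_symm_apply _

/-- The defining square `projPoint ∘ projEmb = ι(ℂ) ∘ (S(Γ) ≃ X(ℂ))`. [cite: SerreGAGA1956, §2 (fonctorialité)] -/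
theorem projPoint_comp_projEmb :
    projPoint N ∘ D.projEmb 𝔣 ι = AlgPoints.map ι ∘ D.quotientSurfaceHomeomorph 𝔣 :=
  funext (D.projPoint_projEmb 𝔣 ι)

/-- **`S(Γ) → ℙᴺ(ℂ)` is holomorphic** (GAGA functoriality: a morphism of smooth varieties read between
analytifications is holomorphic, hence complex-analytic). [cite: SerreGAGA1956, §2 n°6 Prop. 3 Cor. 2] -/
theorem contMDiff_projEmb [IsClosedImmersion ι.left] :
    ContMDiff 𝓘(ℂ, Fin 2 → ℂ) 𝓘(ℂ, Fin N → ℂ) ω (D.projEmb 𝔣 ι) := by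
  haveI : IsManifold 𝓘(ℂ, Fin N → ℂ) ω (ℙ ℂ (Fin (N + 1) → ℂ)) := isManifold_projectivization_holds ℂ N
  haveI : SmoothOfRelativeDimension 2 X₂.hom := D.isSmoothProjective.smoothOfRelativeDimension
  haveI : SmoothOfRelativeDimension N (projectiveSpace N ℂ).hom :=
    (Literature.AlgebraicGeometry.Motives.isSmoothProjective_projectiveSpace_holds ℂ N).smoothOfRelativeDimension
  haveI : IsProper X₂.hom := by rw [← Over.w ι]; infer_instance
  haveI : LocallyOfFiniteType X₂.hom := inferInstance
  have hmd : MDifferentiable 𝓘(ℂ, Fin 2 → ℂ) 𝓘(ℂ, Fin N → ℂ) (D.projEmb 𝔣 ι) :=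
    IsAnalytification.mdifferentiable_comp_map_holds (D.isAnalytification_quotientSurface 𝔣)
      (isAnalytification_projPoint (n := N)) ι (D.projEmb 𝔣 ι) (D.projPoint_comp_projEmb 𝔣 ι)
  exact Literature.Geometry.Kaehler.contMDiff_of_mdifferentiable hmd

/-- **`S(Γ) → ℙᴺ(ℂ)` is injective** (`ι(ℂ)` is injective for a closed immersion `ι`). [cite: Hartshorne1977, II Ex. 2.7 and II Ex. 3.11 (d)] -/
theorem injective_projEmb [IsClosedImmersion ι.left] : Injective (D.projEmb 𝔣 ι) := by
  intro m m' h
  have h1 := congrArg (projPoint N) h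
  rw [projPoint_projEmb, projPoint_projEmb] at h1
  exact (D.quotientSurfaceHomeomorph 𝔣).injective (AlgPoints.map_injective_of_mono (ι := ι) h1)

/-- **`S(Γ) → ℙᴺ(ℂ)` is an immersion** (a closed immersion of smooth varieties analytifies to an immersion).
[cite: SerreGAGA1956, §2 n°6 Prop. 3 Cor. 2] -/
theorem injective_mfderiv_projEmb [IsClosedImmersion ι.left] (m : D.quotientSurface 𝔣) :
    Injective (mfderiv 𝓘(ℂ, Fin 2 → ℂ) 𝓘(ℂ, Fin N → ℂ) (D.projEmb 𝔣 ι) m) := by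
  haveI : IsManifold 𝓘(ℂ, Fin N → ℂ) ω (ℙ ℂ (Fin (N + 1) → ℂ)) := isManifold_projectivization_holds ℂ N
  haveI : SmoothOfRelativeDimension 2 X₂.hom := D.isSmoothProjective.smoothOfRelativeDimension
  haveI : SmoothOfRelativeDimension N (projectiveSpace N ℂ).hom :=
    (Literature.AlgebraicGeometry.Motives.isSmoothProjective_projectiveSpace_holds ℂ N).smoothOfRelativeDimension
  haveI : IsProper X₂.hom := by rw [← Over.w ι]; infer_instance
  haveI : LocallyOfFiniteType X₂.hom := inferInstance
  exact IsAnalytification.injective_mfderiv_of_isClosedImmersion (D.isAnalytification_quotientSurface 𝔣)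
    (isAnalytification_projPoint (n := N)) ι (D.projEmb 𝔣 ι) (D.projPoint_comp_projEmb 𝔣 ι) m

end ProjEmb

end UnitaryBallUniformisationDatum

/-! ### §2 The special curve as a smooth projective closed subscheme -/

namespace UnitaryBallQuotientDatum

variable {X₂ : SchemeOver ℂ} (D : UnitaryBallQuotientDatum 2 X₂) (𝔣 : D.SylvesterFrame)

/-- **Special curves are smooth projective closed subschemes (at injective level).** For a totally positive
line `W = E·s` of a compact ball-quotient datum and a level at which no `γ ∈ Γ ∖ Γ_W` moves a point of
`𝔹_W` into `𝔹_W`, the special subvariety `D.specialSubvariety W ⊆ X` carries a REDUCED closed subscheme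
structure `κ : Z ↪ X` which is SMOOTH PROJECTIVE of dimension `1` over `ℂ` and is analytified by the
compact Riemann surface `Γ_W∖𝔹_W`, compatibly with `Γ_W∖𝔹_W → S(Γ) ≅ X(ℂ)` (Serre GAGA §2 n°5–6 applied
to the closed embedding `Γ_W∖𝔹_W ↪ S(Γ) ↪ ℙᴺ(ℂ)`; Kudla–Millson: «the cycle `C_β` is an algebraic cycle»).
[cite: SerreGAGA1956, §2 n°6 Prop. 3 and Cor. 2] [cite: KudlaMillson1990, Lemma 1.1, p. 128 and p. 133]
[cite: Deligne1971TravauxShimura, Prop. 1.15] -/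
theorem exists_specialCurveSubscheme (s : D.DiscVec 𝔣)
    (hW : IsTotallyPositive (conjRingHom D.E) D.H (D.E ∙ s.1))
    (hinj : ∀ γ : D.Γ, (∃ z ∈ D.specialBall 𝔣 {s.1}, D.ballRep 𝔣 γ • z ∈ D.specialBall 𝔣 {s.1}) →
      γ ∈ D.lineStab (D.E ∙ s.1)) :
    ∃ (Z : SchemeOver ℂ) (κ : Z ⟶ X₂) (_ : IsClosedImmersion κ.left) (_ : IsReduced Z.left)
      (φ₁ : D.specialCurve 𝔣 s → ComplexPoints Z),
      IsSmoothProjective 1 Z ∧ IsAnalytification (Fin 1 → ℂ) Z 1 φ₁ ∧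
      Set.range κ.left = D.specialSubvariety (D.E ∙ s.1) ∧
      ∀ q, AlgPoints.map κ (φ₁ q) = D.quotientSurfaceHomeomorph 𝔣 (D.specialCurveMap 𝔣 s q) := by
  -- a projective embedding of the surface
  obtain ⟨N, ι, hι⟩ := D.isSmoothProjective.isProjectiveOver
  haveI := hι
  haveI : IsManifold 𝓘(ℂ, Fin N → ℂ) ω (ℙ ℂ (Fin (N + 1) → ℂ)) := isManifold_projectivization_holds ℂ N
  -- compactness of the special curve at injective level
  haveI : CompactSpace (D.specialCurve 𝔣 s) := D.compactSpace_specialCurve 𝔣 s hinj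
  -- the reduced induced closed subscheme on the special subvariety
  obtain ⟨Z, κ, hκ, hred, hrange⟩ :=
    ProjectiveManifold.exists_isClosedImmersion_isReduced_range_eq X₂ (D.isClosed_specialSubvariety _ hW)
  haveI := hκ
  haveI := hred
  haveI : IsClosedImmersion (κ ≫ ι).left := inferInstanceAs (IsClosedImmersion (κ.left ≫ ι.left))
  -- the map `Γ_W∖𝔹_W → ℙᴺ(ℂ)`
  set F : D.specialCurve 𝔣 s → ℙ ℂ (Fin (N + 1) → ℂ) := D.projEmb 𝔣 ι ∘ D.specialCurveMap 𝔣 s with hFdef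
  have hF : ContMDiff 𝓘(ℂ, Fin 1 → ℂ) 𝓘(ℂ, Fin N → ℂ) ω F :=
    (D.contMDiff_projEmb 𝔣 ι).comp (D.contMDiff_specialCurveMap 𝔣 s)
  have hFinj : Injective F := (D.injective_projEmb 𝔣 ι).comp (D.specialCurveMap_injective 𝔣 s hinj)
  have hFimm : ∀ q, Injective (mfderiv 𝓘(ℂ, Fin 1 → ℂ) 𝓘(ℂ, Fin N → ℂ) F q) := by
    intro q
    rw [hFdef, mfderiv_comp q ((D.contMDiff_projEmb 𝔣 ι).mdifferentiableAt (by simp))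
      ((D.contMDiff_specialCurveMap 𝔣 s).mdifferentiableAt (by simp))]
    exact (D.injective_mfderiv_projEmb 𝔣 ι _).comp (D.injective_mfderiv_specialCurveMap 𝔣 s q)
  -- the complex points of `Z` in `ℙᴺ(ℂ)` are the image of `F`
  have hpts : Set.range (AlgPoints.map (κ ≫ ι) : ComplexPoints Z → ComplexPoints (projectiveSpace N ℂ)) =
      projPoint N '' Set.range F := by
    -- both sides are `ι(ℂ)` of the complex points of `X` over the special subvariety
    have h1 : Set.range (AlgPoints.map (κ ≫ ι) : ComplexPoints Z → ComplexPoints (projectiveSpace N ℂ)) =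
        AlgPoints.map ι '' {Q : ComplexPoints X₂ | Q.pt ∈ D.specialSubvariety (D.E ∙ s.1)} := by
      rw [AlgPoints.map_comp, Set.range_comp, ProjectiveManifold.range_map_of_isClosedImmersion κ, hrange]
    have h2 : projPoint N '' Set.range F =
        AlgPoints.map ι '' (D.quotientSurfaceHomeomorph 𝔣 '' Set.range (D.specialCurveMap 𝔣 s)) := by
      rw [hFdef, Set.range_comp, ← Set.image_comp, ← Set.image_comp]
      refine Set.image_congr' fun m ↦ ?_
      exact D.projPoint_projEmb 𝔣 ι m
    rw [h1, h2]
    congr 1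
    ext Q
    rw [Set.mem_setOf_eq, D.pt_mem_specialSubvariety_iff _ hW Q, D.range_specialCurveMap 𝔣 s,
      ← D.preimage_quotientSurfaceHomeomorph_image_specialBall 𝔣,
      Set.image_preimage_eq _ (D.quotientSurfaceHomeomorph 𝔣).surjective,
      ← D.image_unif_subCone_eq 𝔣]
  -- `Z` is analytified by `Γ_W∖𝔹_W`
  obtain ⟨φ₁, hφ₁, hcomp⟩ :=
    ProjectiveManifold.exists_isAnalytification_of_range_map_eq (κ ≫ ι) F hF hFinj hpts
  -- hence smooth projective of dimension `1`
  have hsm : IsSmoothProjective 1 Z :=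
    ProjectiveManifold.isSmoothProjective_of_isAnalytification F hF hFinj hFimm (κ ≫ ι) φ₁ hφ₁ hcomp
  refine ⟨Z, κ, hκ, hred, φ₁, hsm, hφ₁, hrange, fun q ↦ ?_⟩
  -- compatibility with `Γ_W∖𝔹_W → S(Γ) ≅ X(ℂ)`, read through the injective `ι(ℂ)`
  apply AlgPoints.map_injective_of_mono (ι := ι)
  rw [← AlgPoints.map_comp_apply, hcomp q]
  exact D.projPoint_projEmb 𝔣 ι _

end UnitaryBallQuotientDatum

end Literature.AlgebraicGeometry.ShimuraVarieties

end
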